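import Literature.NumberTheory.EllipticCurves.PadicLogFiniteExtensionDilationProofs
import Literature.NumberTheory.EllipticCurves.VariableChangePointsMap
import HarnessLib

/-!
# `log_ω` under a GENERAL change of variables `(u, r, s, t)`: `log_{ω'}(ι_C P) = u · log_ω(P)` — PROVED

Topic `NumberTheory/EllipticCurves`; sequel of `PadicLogFiniteExtension.lean` (`limitLog`,
`padicLogPointFiniteExt` over a valued field) and of `PadicLogFiniteExtensionDilationProofs.lean`
(the case `r = s = t = 0`). THEOREMS ONLY. Cell `bsd-schneider-ideate`, seat `bsd-schneider-door-c3`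
(prover, gen 10); consumer: the descent of Castella–Hsieh's value formula (Math. Ann. 370 (2018)
Lemma 5.4 / Thm. 5.7) along the COMPOSITE change `W_{K[p]} = (C₂ · ι_θ⁻¹ · D) • W'_{K[p]}` between
the good partner `W'` and the door curve `W = C₂ • ((D • W') ⊗ χ_{p*})` of route
`SchneiderFreeAdditiveX3` (input `KYRead.KYReadCHValue`, item stmt-BirchSwinnertonDyer-19177): `C₂`,
`D` are ARBITRARY rational changes (the intermediate models need not be `p`-integral), so the dilation
case does not suffice and the logarithms are compared in one step between the integral end models.

## Statements
For `C = (u, r, s, t)` (Silverman, *AEC* III.1: `x = u²x' + r`, `y = u³y' + u²sx' + t`) between two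
`w`-integral Weierstrass equations `V`, `C • V` over a valued field `(K, w)` with `0 < |p| < 1` and
(SPEC) for `limitLog` on both levels (i.e. completeness):
`padicLogPointFiniteExt w (C • V) p (ι_C P) = u · padicLogPointFiniteExt w V p P` — for `|u| ≤ 1`
and every `P` with a positive multiple in the level `E⁽ᵖ⁾` of `V`
(`padicLogPointFiniteExt_pointMap_of_variableChange`; NO hypothesis on `r, s, t`); for `|u| ≥ 1` and
every `P` whose image has a positive multiple in the level of `C • V` (`…_of_one_le`, by the first
case for `C⁻¹` transported along `C⁻¹ • (C • V) = V`); the inverse-map spellings and the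
hypothesis-free forms over a complete nonarchimedean normed field (`…_of_completeSpace`). This is the
rule `u⁻¹ω' = ω` of *AEC* III.1 Table 3.1 read on `log = ∫ω`.

## Proof
`z' − u z = u (r y − s x (x − r) − t x)/((y − s(x − r) − t)·y)` and `|x| = |z|⁻²`, `|y| = |z|⁻³` on
`E₁` give `|z(ι_C P) − u·z(P)| ≤ |u|·M·|z(P)|²` for `M = max(1, |r|, |s|, |t|)`, `M|z| < 1`; deep in
the level the error is `≤ |p|^{r+1}`, so `u·ℓ_p(Q)` has the approximation property defining
`ℓ_p(ι_C Q)`; for an arbitrary point use the multiple `pᵏm • P`, `k` large (`log = ℓ_p(m • ·)/m`).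

References: Silverman, *AEC* III.1 Table 3.1, Prop. III.3.1(b), IV.1 (`z = -x/y`), Thm. IV.6.4,
Prop. VII.2.2; Mazur–Tate–Teitelbaum 1986 §II (`log P = log(mP)/m`).
-/

noncomputable section

open scoped Classical NNReal

namespace Literature.NumberTheory.EllipticCurves.FormalGroupChart

open _root_.WeierstrassCurve _root_.WeierstrassCurve.VariableChange

variable {K : Type*} [Field K] {w : Valuation K ℝ≥0} {V : WeierstrassCurve K} {p : ℕ}
  {C : _root_.WeierstrassCurve.VariableChange K}

/-! ### Transport along an equality of models; the inverse change on points -/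

section Transport

/-- `ι_{C⁻¹} ∘ ι_C` is the identity (on coordinates `u²·(u⁻²(x − r)) + r = x`, …), read along
`C⁻¹ • (C • V) = V`. [cite: SilvermanAEC2009, III.1 Table 3.1 and Prop. III.3.1(b)] -/
theorem pointMap_inv_pointMap (P : V.toAffine.Point) :
    pointMap (C • V) C⁻¹ (pointMap V C P) = Affine.Point.congrEquiv (inv_smul_smul C V).symm P := by
  rcases P with _ | ⟨x, y, h⟩
  · rw [← WeierstrassCurve.Affine.Point.zero_def, pointMap_zero, pointMap_zero,
      Affine.Point.congrEquiv_zero]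
  · rw [pointMap_some, pointMap_some, Affine.Point.congrEquiv_some]
    have hu : (C.u : K) ≠ 0 := C.u.ne_zero
    simp only [WeierstrassCurve.Affine.Point.some.injEq, toX_def, toY_def, inv_def, inv_inv,
      Units.val_inv_eq_inv_val]
    constructor
    · field_simp
      ring
    · field_simp
      ring

variable [hV : V.IsIntegral w.integer]

omit hV in
/-- `log_ω` is transported identically along an equality of models (the identity substitution).
[cite: SilvermanAEC2009, Prop. III.3.1(b)] -/
theorem padicLogPointFiniteExt_congrEquiv {V₁ V₂ : WeierstrassCurve K} [V₁.IsIntegral w.integer]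
    [V₂.IsIntegral w.integer] (h : V₁ = V₂) (P : V₁.toAffine.Point) :
    padicLogPointFiniteExt w V₂ p (Affine.Point.congrEquiv h P) = padicLogPointFiniteExt w V₁ p P := by
  subst h
  rfl

omit hV in
/-- Level membership is transported identically along an equality of models.
[cite: SilvermanAEC2009, Prop. III.3.1(b)] -/
theorem congrEquiv_mem_level_iff {V₁ V₂ : WeierstrassCurve K} [V₁.IsIntegral w.integer]
    [V₂.IsIntegral w.integer] (h : V₁ = V₂) {t : ℝ≥0} (P : V₁.toAffine.Point) :
    Affine.Point.congrEquiv h P ∈ level w V₂ t ↔ P ∈ level w V₁ t := by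
  subst h
  rfl

omit hV in
/-- (SPEC) for `limitLog` is transported identically along an equality of models.
[cite: SilvermanAEC2009, Prop. III.3.1(b) with Thm. IV.6.4] -/
theorem limitLog_spec_congr {V₁ V₂ : WeierstrassCurve K} [V₁.IsIntegral w.integer]
    [V₂.IsIntegral w.integer] (h : V₁ = V₂)
    (hℓ : ∀ Q ∈ level w V₁ (w (p : K)), ∀ r : ℕ,
      w (limitLog w V₁ p Q - ((p ^ r) • Q).zCoord / (p : K) ^ r) ≤ w (p : K) ^ (r + 1)) :
    ∀ Q ∈ level w V₂ (w (p : K)), ∀ r : ℕ,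
      w (limitLog w V₂ p Q - ((p ^ r) • Q).zCoord / (p : K) ^ r) ≤ w (p : K) ^ (r + 1) := by
  subst h
  exact hℓ

end Transport

/-! ### The chart parameter under a general change of variables -/

section Chart

variable [hV : V.IsIntegral w.integer]

/-- **`|z(ι_C P) − u·z(P)| ≤ |u|·M·|z(P)|²` deep in `E₁`**, for `C = (u, r, s, t)` with
`|r|, |s|, |t| ≤ M`, `1 ≤ M` and `M·|z(P)| < 1`: from `z' = -x'/y' = -u(x − r)/(y − s(x − r) − t)`,
`z' − u z = u (r y − s x (x − r) − t x)/((y − s(x − r) − t) y)` and the sizes `|x| = |z|⁻²`,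
`|y| = |z|⁻³` on `E₁` (Silverman *AEC* VII.2.2; the perturbations `r`, `s(x − r)`, `t` are strictly
smaller than `x`, `y`, `y` in the range `M|z| < 1`). [cite: SilvermanAEC2009, III.1 Table 3.1 with Prop. VII.2.2] -/
theorem val_zCoord_pointMap_sub_le {M : ℝ≥0} (hM : 1 ≤ M) (hr : w C.r ≤ M) (hs : w C.s ≤ M)
    (ht : w C.t ≤ M) {P : V.toAffine.Point} (hP : P ∈ kernel w V) (hz : M * w P.zCoord < 1) :
    w ((pointMap V C P).zCoord - (C.u : K) * P.zCoord) ≤ w (C.u : K) * M * w P.zCoord ^ 2 := by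
  rcases P with _ | ⟨x, y, h⟩
  · rw [← WeierstrassCurve.Affine.Point.zero_def, pointMap_zero]
    simp only [WeierstrassCurve.Affine.Point.zCoord_zero, mul_zero, sub_zero, map_zero, zero_le]
  · obtain ⟨hy0, hz1, hxz, hyz, -, hzpos⟩ := val_zw h.left (hP rfl)
    rw [WeierstrassCurve.Affine.Point.zCoord_some] at hz ⊢
    set ρ : ℝ≥0 := w (-x / y) with hρ
    have hρ0 : ρ ≠ 0 := hzpos.ne'
    have hρ1' : ρ ≤ 1 := hz1.le
    -- sizes of `x`, `y`
    have hx : w x = (ρ ^ 2)⁻¹ := eq_inv_of_mul_eq_one_left hxz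
    have hy : w y = (ρ ^ 3)⁻¹ := eq_inv_of_mul_eq_one_left hyz
    have hρ2 : ρ ^ 2 ≠ 0 := pow_ne_zero _ hρ0
    have hρ3 : ρ ^ 3 ≠ 0 := pow_ne_zero _ hρ0
    have hρ4 : ρ ^ 4 ≠ 0 := pow_ne_zero _ hρ0
    -- `M < |z|⁻² = |x|` and `M < |z|⁻³ = |y|`
    have hMρ : M * ρ < 1 := hz
    have hM_lt_x : M < w x := by
      rw [hx, ← one_mul ((ρ ^ 2)⁻¹), lt_mul_inv_iff₀ (pos_iff_ne_zero.mpr hρ2)]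
      calc M * ρ ^ 2 = (M * ρ) * ρ := by ring
        _ ≤ (M * ρ) * 1 := by gcongr
        _ < 1 := by rw [mul_one]; exact hMρ
    have hM_lt_y : M < w y := by
      rw [hy, ← one_mul ((ρ ^ 3)⁻¹), lt_mul_inv_iff₀ (pos_iff_ne_zero.mpr hρ3)]
      calc M * ρ ^ 3 = (M * ρ) * ρ ^ 2 := by ring
        _ ≤ (M * ρ) * 1 := by gcongr; exact pow_le_one₀ zero_le hρ1'
        _ < 1 := by rw [mul_one]; exact hMρ
    -- `|x - r| = |x|`
    have hxr : w (x - C.r) = w x := Valuation.map_sub_eq_of_lt_left _ (hr.trans_lt hM_lt_x)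
    -- `|s (x - r)| < |y|` and `|t| < |y|`, so `|y - s(x - r) - t| = |y|`
    have hsx : w (C.s * (x - C.r)) < w y := by
      rw [map_mul, hxr, hx, hy, ← one_mul ((ρ ^ 3)⁻¹), lt_mul_inv_iff₀ (pos_iff_ne_zero.mpr hρ3)]
      calc w C.s * (ρ ^ 2)⁻¹ * ρ ^ 3 = w C.s * ρ := by field_simp

        _ ≤ M * ρ := by gcongr
        _ < 1 := hMρ
    set d : K := y - C.s * (x - C.r) - C.t with hd
    have hdy : w d = w y := by
      have e : d = y - (C.s * (x - C.r) + C.t) := by rw [hd]; ring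
      rw [e]
      exact Valuation.map_sub_eq_of_lt_left _
        ((w.map_add _ _).trans_lt (max_lt hsx (ht.trans_lt hM_lt_y)))
    have hd0 : d ≠ 0 := by
      intro h0
      rw [h0, map_zero] at hdy
      rw [← hdy] at hM_lt_y
      exact not_lt_zero hM_lt_y
    have hu0 : (C.u : K) ≠ 0 := C.u.ne_zero
    -- the algebraic identity
    have key : WeierstrassCurve.Affine.Point.zCoord (pointMap V C (.some x y h)) - (C.u : K) * (-x / y) =
        (C.u : K) * ((C.r * y - C.s * x * (x - C.r) - C.t * x) / (d * y)) := by
      rw [pointMap_some, WeierstrassCurve.Affine.Point.zCoord_some, toX_def, toY_def,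
        Units.val_inv_eq_inv_val, ← hd]
      field_simp
      ring
    rw [key, map_mul, map_div₀, map_mul, hdy]
    have hyy : 0 < w y * w y := by rw [hy]; positivity
    have hnum : w (C.r * y - C.s * x * (x - C.r) - C.t * x) ≤ M * (ρ ^ 4)⁻¹ := by
      refine Valuation.map_sub_le _ (Valuation.map_sub_le _ ?_ ?_) ?_
      · rw [map_mul, hy, le_mul_inv_iff₀ (pos_iff_ne_zero.mpr hρ4)]
        calc w C.r * (ρ ^ 3)⁻¹ * ρ ^ 4 = w C.r * ρ := by field_simp
          _ ≤ M * 1 := by gcongr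
          _ = M := mul_one M
      · rw [map_mul, map_mul, hxr, hx, le_mul_inv_iff₀ (pos_iff_ne_zero.mpr hρ4)]
        calc w C.s * (ρ ^ 2)⁻¹ * (ρ ^ 2)⁻¹ * ρ ^ 4 = w C.s := by field_simp
          _ ≤ M := hs
      · rw [map_mul, hx, le_mul_inv_iff₀ (pos_iff_ne_zero.mpr hρ4)]
        calc w C.t * (ρ ^ 2)⁻¹ * ρ ^ 4 = w C.t * ρ ^ 2 := by field_simp
          _ ≤ M * 1 := by gcongr; exact pow_le_one₀ zero_le hρ1'
          _ = M := mul_one M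
    have hfrac : w (C.r * y - C.s * x * (x - C.r) - C.t * x) / (w y * w y) ≤ M * ρ ^ 2 := by
      rw [div_le_iff₀ hyy, hy]
      refine hnum.trans (le_of_eq ?_)
      field_simp
    calc w (C.u : K) * (w (C.r * y - C.s * x * (x - C.r) - C.t * x) / (w y * w y))
        ≤ w (C.u : K) * (M * ρ ^ 2) := by gcongr
      _ = w (C.u : K) * M * ρ ^ 2 := (mul_assoc _ _ _).symm

/-- In the range `M|z(P)| < 1` (with `|r|, |s|, |t| ≤ M`, `1 ≤ M`): **`|z(ι_C P)| = |u|·|z(P)|`**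
(the error term of `val_zCoord_pointMap_sub_le` is strictly smaller than `|u|·|z(P)|`).
[cite: SilvermanAEC2009, III.1 Table 3.1 with Prop. VII.2.2] -/
theorem val_zCoord_pointMap_eq {M : ℝ≥0} (hM : 1 ≤ M) (hr : w C.r ≤ M) (hs : w C.s ≤ M)
    (ht : w C.t ≤ M) {P : V.toAffine.Point} (hP : P ∈ kernel w V) (hz : M * w P.zCoord < 1) :
    w (pointMap V C P).zCoord = w (C.u : K) * w P.zCoord := by
  by_cases hP0 : P.zCoord = 0
  · have hP' : P = 0 := (zCoord_eq_zero_iff hP).mp hP0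
    subst hP'
    rw [pointMap_zero]
    simp only [WeierstrassCurve.Affine.Point.zCoord_zero, map_zero, mul_zero]
  rw [← map_mul]
  refine Valuation.map_eq_of_sub_lt _ ((val_zCoord_pointMap_sub_le hM hr hs ht hP hz).trans_lt ?_)
  have hu0 : 0 < w (C.u : K) := (Valuation.pos_iff w).mpr C.u.ne_zero
  have hz0 : 0 < w P.zCoord := (Valuation.pos_iff w).mpr hP0
  rw [map_mul, mul_assoc, pow_two, ← mul_assoc M]
  calc w (C.u : K) * (M * w P.zCoord * w P.zCoord)
      < w (C.u : K) * (1 * w P.zCoord) := by gcongr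
    _ = w (C.u : K) * w P.zCoord := by rw [one_mul]

variable [hV' : (C • V).IsIntegral w.integer]

/-- **A change of variables with `|u| ≤ 1` maps the part `M|z| < 1` of `E₁(V)` into `E₁(C • V)`**
(`|x'| = |u|⁻²|x − r| = |u|⁻²|x| > 1` since `|r| ≤ M < |x|`).
[cite: SilvermanAEC2009, Prop. VII.2.2 (E₁: |x| > 1)] -/
theorem pointMap_mem_kernel_of_variableChange {M : ℝ≥0} (hr : w C.r ≤ M)
    (hu : w (C.u : K) ≤ 1) {P : V.toAffine.Point} (hP : P ∈ kernel w V)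
    (hz : M * w P.zCoord < 1) : pointMap V C P ∈ kernel w (C • V) := by
  rcases P with _ | ⟨x, y, h⟩
  · exact (kernel w (C • V)).zero_mem
  · rw [pointMap_some]
    refine some_mem_kernel _ ?_
    obtain ⟨hy0, hz1, hxz, hyz, -, hzpos⟩ := val_zw h.left (hP rfl)
    rw [WeierstrassCurve.Affine.Point.zCoord_some] at hz
    have hρ0 : w (-x / y) ≠ 0 := hzpos.ne'
    have hx1 : 1 < w x := (some_mem_kernel_iff h).mp hP
    have hx : w x = (w (-x / y) ^ 2)⁻¹ := eq_inv_of_mul_eq_one_left hxz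
    have hM_lt_x : M < w x := by
      rw [hx, ← one_mul ((w (-x / y) ^ 2)⁻¹),
        lt_mul_inv_iff₀ (pos_iff_ne_zero.mpr (pow_ne_zero _ hρ0))]
      calc M * w (-x / y) ^ 2 = (M * w (-x / y)) * w (-x / y) := by ring
        _ ≤ (M * w (-x / y)) * 1 := mul_le_mul_right hz1.le _
        _ < 1 := by rw [mul_one]; exact hz
    have hxr : w (x - C.r) = w x := Valuation.map_sub_eq_of_lt_left _ (hr.trans_lt hM_lt_x)
    have hu0 : w (C.u : K) ≠ 0 := (Valuation.ne_zero_iff w).mpr C.u.ne_zero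
    rw [toX_def, map_mul, map_pow, Units.val_inv_eq_inv_val, map_inv₀, hxr]
    have h1 : 1 ≤ (w (C.u : K))⁻¹ := one_le_inv_iff₀.mpr ⟨pos_iff_ne_zero.mpr hu0, hu⟩
    calc (1 : ℝ≥0) = 1 ^ 2 * 1 := by ring
      _ < (w (C.u : K))⁻¹ ^ 2 * w x := by
        exact mul_lt_mul' (pow_le_pow_left' h1 2) hx1 zero_le (by positivity)

/-- **Deep in the level, a change of variables with `|u| ≤ 1` maps `E⁽ᵗ⁾(V)` into `E⁽ᵗ⁾(C • V)`**
(`|z'| = |u||z| ≤ |z|`). [cite: SilvermanAEC2009, Prop. VII.2.2] -/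
theorem pointMap_mem_level_of_variableChange {M : ℝ≥0} (hM : 1 ≤ M) (hr : w C.r ≤ M)
    (hs : w C.s ≤ M) (ht : w C.t ≤ M) (hu : w (C.u : K) ≤ 1) {t : ℝ≥0} {P : V.toAffine.Point}
    (hP : P ∈ level w V t) (hz : M * w P.zCoord < 1) : pointMap V C P ∈ level w (C • V) t := by
  refine ⟨pointMap_mem_kernel_of_variableChange hr hu hP.1 hz, ?_⟩
  rw [val_zCoord_pointMap_eq hM hr hs ht hP.1 hz]
  exact (mul_le_of_le_one_left' hu).trans hP.2

end Chart

/-! ### The limit logarithm and `log_ω` under a general change of variables, `|u| ≤ 1` -/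

section Log

/-- Uniqueness of `|p|`-adic limits: two values approximating the same sequence to within `|p|^{r+1}`
for every `r` are equal (`|p| < 1`). [cite: SilvermanAEC2009, Thm. IV.6.4 (uniqueness of the limit)] -/
private theorem eq_of_forall_val_sub_le_pow'' (hp1 : w (p : K) < 1) {x : ℕ → K} {y y' : K}
    (hy : ∀ r, w (y - x r) ≤ w (p : K) ^ (r + 1)) (hy' : ∀ r, w (y' - x r) ≤ w (p : K) ^ (r + 1)) :
    y = y' := by
  by_contra hne
  have hpos : 0 < w (y - y') := pos_iff_ne_zero.mpr (by rwa [Valuation.ne_zero_iff, sub_ne_zero])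
  obtain ⟨r, hr⟩ := exists_pow_lt_of_lt_one hpos hp1
  have hle : w (y - y') ≤ w (p : K) ^ (r + 1) := by
    have e : y - y' = (y - x r) - (y' - x r) := by ring
    rw [e]
    exact (Valuation.map_sub w _ _).trans (max_le (hy r) (hy' r))
  have hlt : w (p : K) ^ (r + 1) ≤ w (p : K) ^ r := by
    rw [pow_succ]
    exact mul_le_of_le_one_right' hp1.le
  exact absurd (hle.trans hlt) (not_le.mpr hr)

variable [hV : V.IsIntegral w.integer]

/-- **`ℓ_p(ι_C Q) = u · ℓ_p(Q)` deep in the level `E⁽ᵖ⁾`** (`M|z(Q)| < 1`), for a change of variables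
with `|u| ≤ 1` and `|r|, |s|, |t| ≤ M`: with `R = pʳ·Q`, `|z(ι_C R) − u z(R)|/|p|ʳ ≤ M|p|ʳ|z(Q)|²
≤ |p|^{r+1}` and `|u ℓ_p(Q) − u z(R)/pʳ| ≤ |u||p|^{r+1}`, so `u·ℓ_p(Q)` has the approximation
property defining `ℓ_p(ι_C Q)`. Hypothesis `hℓ`: (SPEC) for `limitLog` on the level of `V`.
[cite: SilvermanAEC2009, Thm. IV.6.4 with III.1 Table 3.1] -/
theorem limitLog_pointMap_of_variableChange (hp0 : (p : K) ≠ 0) (hp1 : w (p : K) < 1) {M : ℝ≥0}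
    (hM : 1 ≤ M) (hr : w C.r ≤ M) (hs : w C.s ≤ M) (ht : w C.t ≤ M) (hu : w (C.u : K) ≤ 1)
    (hℓ : ∀ Q ∈ level w V (w (p : K)), ∀ r : ℕ,
      w (limitLog w V p Q - ((p ^ r) • Q).zCoord / (p : K) ^ r) ≤ w (p : K) ^ (r + 1))
    {Q : V.toAffine.Point} (hQ : Q ∈ level w V (w (p : K))) (hz : M * w Q.zCoord < 1) :
    limitLog w (C • V) p (pointMap V C Q) = (C.u : K) * limitLog w V p Q := by
  have hp : 0 < w (p : K) := (Valuation.pos_iff w).mpr hp0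
  -- `u · ℓ_p(Q)` has (SPEC) for the transformed point
  have hy : ∀ r : ℕ, w ((C.u : K) * limitLog w V p Q -
      ((p ^ r) • pointMap V C Q).zCoord / (p : K) ^ r) ≤ w (p : K) ^ (r + 1) := by
    intro r
    have hR : (p ^ r) • Q ∈ kernel w V := (kernel w V).nsmul_mem hQ.1 _
    have hRz : w ((p ^ r) • Q).zCoord ≤ w (p : K) ^ r * w Q.zCoord :=
      val_zCoord_pow_smul_le hQ.1 hQ.2 r
    have hRz' : M * w ((p ^ r) • Q).zCoord < 1 := by
      calc M * w ((p ^ r) • Q).zCoord ≤ M * (w (p : K) ^ r * w Q.zCoord) := by gcongr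
        _ ≤ M * (1 * w Q.zCoord) := by gcongr; exact pow_le_one₀ zero_le hp1.le
        _ = M * w Q.zCoord := by rw [one_mul]
        _ < 1 := hz
    have e : ((p ^ r) • pointMap V C Q).zCoord = (pointMap V C ((p ^ r) • Q)).zCoord := by
      rw [← pointEquiv_apply, ← map_nsmul, pointEquiv_apply]
    have hA := val_zCoord_pointMap_sub_le hM hr hs ht hR hRz'
    have e2 : (C.u : K) * limitLog w V p Q - (pointMap V C ((p ^ r) • Q)).zCoord / (p : K) ^ r =
        (C.u : K) * (limitLog w V p Q - ((p ^ r) • Q).zCoord / (p : K) ^ r) -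
          ((pointMap V C ((p ^ r) • Q)).zCoord - (C.u : K) * ((p ^ r) • Q).zCoord) /
            (p : K) ^ r := by
      ring
    rw [e, e2]
    refine Valuation.map_sub_le _ ?_ ?_
    · rw [map_mul]
      exact (mul_le_of_le_one_left' hu).trans (hℓ Q hQ r)
    · rw [map_div₀, map_pow, div_le_iff₀ (pow_pos hp _)]
      calc w ((pointMap V C ((p ^ r) • Q)).zCoord - (C.u : K) * ((p ^ r) • Q).zCoord)
          ≤ w (C.u : K) * M * w ((p ^ r) • Q).zCoord ^ 2 := hA
        _ ≤ 1 * M * (w (p : K) ^ r * w Q.zCoord) ^ 2 := by gcongr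
        _ = (M * w Q.zCoord) * w Q.zCoord * (w (p : K) ^ r * w (p : K) ^ r) := by ring
        _ ≤ 1 * w (p : K) * (w (p : K) ^ r * w (p : K) ^ r) := by
            have h1 : M * w Q.zCoord ≤ 1 := hz.le
            have h2 : w Q.zCoord ≤ w (p : K) := hQ.2
            gcongr
        _ = w (p : K) ^ (r + 1) * w (p : K) ^ r := by ring
  exact eq_of_forall_val_sub_le_pow'' hp1 (limitLog_spec_of_exists ⟨_, hy⟩) hy

variable [hV' : (C • V).IsIntegral w.integer]

/-- **`log_{ω'}(ι_C P) = u · log_ω(P)` for a general change of variables `C = (u, r, s, t)`, `|u| ≤ 1`**,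
between two `w`-integral models, for every `P` with a positive multiple in the level `E⁽ᵖ⁾` of `V`
— NO hypothesis on `r, s, t`: use the multiple `pᵏ m • P` with `M|p|ᵏ < 1` (`M = max(1, |r|, |s|, |t|)`),
where `limitLog_pointMap_of_variableChange` applies, and `log = ℓ_p(m' • ·)/m'` on both models.
`hℓ`, `hℓ'`: (SPEC) for `limitLog` on both levels (`limitLog_spec_of_completeSpace`). This is
`u⁻¹ω' = ω` (*AEC* III.1 Table 3.1) read on `log = ∫ω`.
[cite: SilvermanAEC2009, III.1 Table 3.1 with Thm. IV.6.4 and Prop. VII.2.2]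
[cite: MazurTateTeitelbaum1986, §II (log P = log(mP)/m)] -/
theorem padicLogPointFiniteExt_pointMap_of_variableChange (hp0 : (p : K) ≠ 0)
    (hp1 : w (p : K) < 1) (hu : w (C.u : K) ≤ 1)
    (hℓ : ∀ Q ∈ level w V (w (p : K)), ∀ r : ℕ,
      w (limitLog w V p Q - ((p ^ r) • Q).zCoord / (p : K) ^ r) ≤ w (p : K) ^ (r + 1))
    (hℓ' : ∀ Q ∈ level w (C • V) (w (p : K)), ∀ r : ℕ,
      w (limitLog w (C • V) p Q - ((p ^ r) • Q).zCoord / (p : K) ^ r) ≤ w (p : K) ^ (r + 1))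
    {P : V.toAffine.Point} {m : ℕ} (hm : 0 < m) (hmP : m • P ∈ level w V (w (p : K))) :
    padicLogPointFiniteExt w (C • V) p (pointMap V C P) =
      (C.u : K) * padicLogPointFiniteExt w V p P := by
  -- the size of the change of variables
  set M : ℝ≥0 := max 1 (max (w C.r) (max (w C.s) (w C.t))) with hMdef
  have hM : 1 ≤ M := le_max_left _ _
  have hr : w C.r ≤ M := (le_max_left _ _).trans (le_max_right _ _)
  have hs : w C.s ≤ M :=
    ((le_max_left _ _).trans (le_max_right _ _)).trans (le_max_right _ _)
  have ht : w C.t ≤ M :=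
    ((le_max_right _ _).trans (le_max_right _ _)).trans (le_max_right _ _)
  have hM0 : 0 < M := zero_lt_one.trans_le hM
  have hp : 0 < w (p : K) := (Valuation.pos_iff w).mpr hp0
  have hpn : p ≠ 0 := by
    rintro rfl
    exact hp0 (by rw [Nat.cast_zero])
  -- go deep: `k` with `M · |p|ᵏ < 1`
  obtain ⟨k, hk⟩ := exists_pow_lt_of_lt_one (inv_pos.mpr hM0) hp1
  set R : V.toAffine.Point := (p ^ k) • (m • P) with hRdef
  have hRlev : R ∈ level w V (w (p : K)) := (level w V _).nsmul_mem hmP _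
  have hRz : M * w R.zCoord < 1 := by
    calc M * w R.zCoord ≤ M * (w (p : K) ^ k * w (m • P).zCoord) := by
          gcongr; exact val_zCoord_pow_smul_le hmP.1 hmP.2 k
      _ ≤ M * (w (p : K) ^ k * 1) := by gcongr; exact hmP.2.trans hp1.le
      _ = M * w (p : K) ^ k := by rw [mul_one]
      _ < M * M⁻¹ := by gcongr
      _ = 1 := mul_inv_cancel₀ hM0.ne'
  have hRlev' : pointMap V C R ∈ level w (C • V) (w (p : K)) :=
    pointMap_mem_level_of_variableChange hM hr hs ht hu hRlev hRz
  have hm' : 0 < p ^ k * m := Nat.mul_pos (pow_pos (Nat.pos_of_ne_zero hpn) _) hm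
  have eR : (p ^ k * m) • P = R := by rw [hRdef, mul_nsmul']
  have eR' : (p ^ k * m) • pointMap V C P = pointMap V C R := by
    rw [← pointEquiv_apply, ← map_nsmul, pointEquiv_apply, eR]
  rw [padicLogPointFiniteExt_eq_div hp0 hp1 hℓ' hm' (eR' ▸ hRlev'),
    padicLogPointFiniteExt_eq_div hp0 hp1 hℓ hm' (eR ▸ hRlev), eR', eR,
    limitLog_pointMap_of_variableChange hp0 hp1 hM hr hs ht hu hℓ hRlev hRz, mul_div_assoc]

/-- **The inverse map, `|u| ≤ 1`: `log_ω(ι_C⁻¹ P') = u⁻¹ · log_{ω'}(P')`** for every point `P'` of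
`C • V` whose preimage has a positive multiple in the level of `V`.
[cite: SilvermanAEC2009, III.1 Table 3.1 with Thm. IV.6.4 and Prop. VII.2.2] -/
theorem padicLogPointFiniteExt_pointInv_of_variableChange (hp0 : (p : K) ≠ 0)
    (hp1 : w (p : K) < 1) (hu : w (C.u : K) ≤ 1)
    (hℓ : ∀ Q ∈ level w V (w (p : K)), ∀ r : ℕ,
      w (limitLog w V p Q - ((p ^ r) • Q).zCoord / (p : K) ^ r) ≤ w (p : K) ^ (r + 1))
    (hℓ' : ∀ Q ∈ level w (C • V) (w (p : K)), ∀ r : ℕ,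
      w (limitLog w (C • V) p Q - ((p ^ r) • Q).zCoord / (p : K) ^ r) ≤ w (p : K) ^ (r + 1))
    {P' : (C • V).toAffine.Point} {m : ℕ} (hm : 0 < m)
    (hmP : m • pointInv V C P' ∈ level w V (w (p : K))) :
    padicLogPointFiniteExt w V p (pointInv V C P') =
      (C.u : K)⁻¹ * padicLogPointFiniteExt w (C • V) p P' := by
  have h := padicLogPointFiniteExt_pointMap_of_variableChange hp0 hp1 hu hℓ hℓ' hm hmP
  rw [pointMap_pointInv] at h
  rw [h, ← mul_assoc, inv_mul_cancel₀ C.u.ne_zero, one_mul]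

end Log

end Literature.NumberTheory.EllipticCurves.FormalGroupChart

end
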